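import Literature.RepresentationTheory.FiniteGroups.StableLatticeReductionInvariantInt
import Literature.RepresentationTheory.LatticesInRationalRepresentation
import Mathlib.GroupTheory.SpecificGroups.Cyclic
import HarnessLib

/-!
# Reduction mod `p` along a `G`-homomorphism of lattices: `ψ(Λ₁/p) = ψ((ker j)/p) + ψ(Λ₂/p)`, the
# cyclic torsion `ψ(T/pT) = ψ(T[p])`, and the passage from a RATIONAL isomorphism to reductions

Topic `RepresentationTheory/FiniteGroups`; namespace `Literature.RepresentationTheory.FiniteGroups`,
sub-namespace `StableLatticeReduction.Int` (continuation of the tree's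
`StableLatticeReductionInvariantInt`: Serre §15.2 Thm. 32 over `ℤ` for invariants additive on finite
`p`-torsion modules).  THEOREMS ONLY (no definition, no named fact, no `sorry`, no instance).

Setting: `G` a monoid, `p` a prime, `ψ` a function on `ℤ`-linear `G`-representations with values in
an abelian group `A`, additive on short exact sequences `0 → X → Y → Z → 0` whose middle term is
FINITE AND KILLED BY `p` (the binder pair `(ψ) (hψ)` of the tree file, verbatim).

* §1 **`additive_reduction_eq_ker_add_range`**: for a `G`-map `j : Λ₁ → Λ₂` into a module without
  `p`-torsion, `ψ(Λ₁/pΛ₁) = ψ(T/pT) + ψ(P/pP)` with `T = ker j`, `P = range j` — the sequence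
  `0 → T/pT → Λ₁/pΛ₁ → P/pP → 0` is exact because `P` has no `p`-torsion (Milne I Lemma 2.12 /
  Cassels–Fröhlich IV §8: "the kernel of `λ` is finite, `h(L_T) = h(M⁰)`").
* §2 **`additive_reduction_eq_torsionBy_of_isAddCyclic`**: for a FINITE CYCLIC `T` (any `ℤ`-linear
  `G`-action), `ψ(T/pT) = ψ(T[p])` — if `p ∤ #T` both vanish; if `#T = p·m`, multiplication by `m`
  is a `G`-isomorphism `T/pT ≅ T[p]` (counting with `#{x | k•x = 0} ≤ k` in a cyclic group).  For a
  non-cyclic `T` it fails in general; `additive_torsionBy_eq_quotient` needs additivity on ALL finite modules.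
* §3 **`additive_reduction_eq_torsionBy_add_of_span_eq_top`**: the consumer form.  Two finitely
  generated `ℤ[G]`-modules `Λ₁`, `Λ₂` mapped `G`-equivariantly into one `ℚ[G]`-module with spanning
  images, `i₂` injective, the kernel of `i₁` (= the torsion of `Λ₁` for a rational structure) CYCLIC:
  **`ψ(Λ₁/pΛ₁) = ψ(Λ₁[p]) + ψ(Λ₂/pΛ₂)`** — by `LatticesInRationalRepresentation.exists_equivariant_hom_of_span_eq_top`
  (a `G`-map `j : Λ₁ → Λ₂` of finite-index image with `ker j = ker i₁`), Serre's Thm. 32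
  (`additive_reduction_eq_of_finite_index`: `ψ(Λ₂/p) = ψ(j(Λ₁)/p)`), §1 and §2.

Lane «TATE-EPC-TC» of cell `bsd-eis`, brick B7c (with Herbrand's rational isomorphism of
`EquivariantSUnitRank` it yields `[𝒪_{E,S}^×/p] + [𝔽_p] = [μ(E)[p]] + [𝔽_p[S_E ⊔ S_∞(E)]]`).

## References
* [SerreLinearRepresentations1977] J.-P. Serre, *Linear Representations of Finite Groups*, §15.2 Thm. 32.
* [MilneADT2006] J. S. Milne, *Arithmetic Duality Theorems*, I Lemma 2.12, Lemma 5.3;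
  [CasselsFrohlichANT1967] Cassels–Fröhlich, *Algebraic Number Theory*, Ch. IV §8, Ch. VII §8.3.
-/

universe u v

namespace Literature.RepresentationTheory.FiniteGroups

namespace StableLatticeReduction.Int

open Function LinearMap Submodule StableLatticeReduction
open scoped Pointwise

variable {G : Type*} [Monoid G] {A : Type*} [AddCommGroup A] {p : ℕ}

/-! ### §0. Module-theoretic preliminaries -/

/-- Membership in `r • ⊤`: `x = r • y`. [cite: SerreLinearRepresentations1977, §15.2] -/
theorem mem_smul_top_iff {X : Type u} [AddCommGroup X] (r : ℤ) (x : X) :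
    x ∈ (r • ⊤ : Submodule ℤ X) ↔ ∃ y : X, r • y = x := by
  rw [mem_smul_pointwise_iff_exists]
  exact ⟨fun ⟨y, _, h⟩ => ⟨y, h⟩, fun ⟨y, h⟩ => ⟨y, mem_top, h⟩⟩

/-- A finitely generated `ℤ`-module has finite reduction `Λ/nΛ` for `n ≠ 0` (a finitely generated
torsion group is finite). [cite: SerreLinearRepresentations1977, §15.2] -/
theorem finite_quotient_smul_top {Λ : Type u} [AddCommGroup Λ] [Module.Finite ℤ Λ] {n : ℤ}
    (hn : n ≠ 0) : Finite (Λ ⧸ (n • ⊤ : Submodule ℤ Λ)) := by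
  haveI : Module.Finite ℤ (Λ ⧸ (n • ⊤ : Submodule ℤ Λ)) := Module.Finite.quotient ℤ _
  refine Module.finite_of_fg_torsion _ fun z => ⟨⟨n, mem_nonZeroDivisors_of_ne_zero hn⟩, ?_⟩
  rw [Submonoid.mk_smul]
  exact smul_quotient_smul_top_eq_zero n z

section Additive

variable (ψ : ∀ ⦃X : Type u⦄ [AddCommGroup X] [Module ℤ X], Representation ℤ G X → A)
  (hψ : ∀ ⦃X Y Z : Type u⦄ [AddCommGroup X] [Module ℤ X] [AddCommGroup Y] [Module ℤ Y]
    [AddCommGroup Z] [Module ℤ Z] (ρX : Representation ℤ G X) (ρY : Representation ℤ G Y)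
    (ρZ : Representation ℤ G Z) (f : X →ₗ[ℤ] Y) (g : Y →ₗ[ℤ] Z),
    (∀ s x, f (ρX s x) = ρY s (f x)) → (∀ s y, g (ρY s y) = ρZ s (g y)) →
    Injective f → Surjective g → LinearMap.range f = LinearMap.ker g → Finite Y →
    (∀ y : Y, (p : ℤ) • y = 0) → ψ ρY = ψ ρX + ψ ρZ)
include hψ

/-! ### §1. Reduction along a `G`-homomorphism into a module without `p`-torsion -/

/-- **`ψ(Λ₁/pΛ₁) = ψ((ker j)/p) + ψ((range j)/p)`** for a `G`-map `j : Λ₁ → Λ₂` into a module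
without `p`-torsion (`Λ₁/pΛ₁` finite): the sequence `0 → T/pT → Λ₁/pΛ₁ → P/pP → 0` (`T = ker j`,
`P = range j`) is short exact — a `t ∈ T ∩ pΛ₁`, `t = p λ`, has `p·j(λ) = 0`, so `λ ∈ T`.
[cite: MilneADT2006, I Lemma 2.12] [cite: CasselsFrohlichANT1967, Ch. IV §8] -/
theorem additive_reduction_eq_ker_add_range {Λ₁ Λ₂ : Type u} [AddCommGroup Λ₁] [AddCommGroup Λ₂]
    (ρ₁ : Representation ℤ G Λ₁) (ρ₂ : Representation ℤ G Λ₂) (j : Λ₁ →ₗ[ℤ] Λ₂)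
    (hj : ∀ s x, j (ρ₁ s x) = ρ₂ s (j x)) (htor₂ : ∀ y : Λ₂, (p : ℤ) • y = 0 → y = 0)
    [Finite (Λ₁ ⧸ ((p : ℤ) • ⊤ : Submodule ℤ Λ₁))] :
    ψ (ρ₁.quotient ((p : ℤ) • ⊤) (smul_top_le_comap ρ₁ (p : ℤ))) =
      ψ ((ρ₁.subrepresentation (LinearMap.ker j) (ker_le_comap_of_comm ρ₁ ρ₂ j hj)).quotient
          ((p : ℤ) • ⊤) (smul_top_le_comap _ (p : ℤ))) +
        ψ ((ρ₂.subrepresentation (LinearMap.range j) (range_le_comap_of_comm ρ₁ ρ₂ j hj)).quotient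
          ((p : ℤ) • ⊤) (smul_top_le_comap _ (p : ℤ))) := by
  set T : Submodule ℤ Λ₁ := LinearMap.ker j with hTdef
  set P : Submodule ℤ Λ₂ := LinearMap.range j with hPdef
  set ρT := ρ₁.subrepresentation T (ker_le_comap_of_comm ρ₁ ρ₂ j hj) with hρT
  set ρP := ρ₂.subrepresentation P (range_le_comap_of_comm ρ₁ ρ₂ j hj) with hρP
  -- the two maps
  have hf₀ : ((p : ℤ) • ⊤ : Submodule ℤ T) ≤ ((p : ℤ) • ⊤ : Submodule ℤ Λ₁).comap T.subtype := by
    intro t ht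
    obtain ⟨u, rfl⟩ := (mem_smul_top_iff _ _).1 ht
    exact (mem_smul_top_iff _ _).2 ⟨(u : Λ₁), by rw [Submodule.coe_subtype, Submodule.coe_smul]⟩
  let jP : Λ₁ →ₗ[ℤ] P := j.rangeRestrict
  have hg₀ : ((p : ℤ) • ⊤ : Submodule ℤ Λ₁) ≤ ((p : ℤ) • ⊤ : Submodule ℤ P).comap jP := by
    intro x hx
    obtain ⟨y, rfl⟩ := (mem_smul_top_iff _ _).1 hx
    exact (mem_smul_top_iff _ _).2 ⟨jP y, by rw [map_zsmul]⟩
  let f := Submodule.mapQ _ _ T.subtype hf₀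
  let g := Submodule.mapQ _ _ jP hg₀
  refine hψ (ρT.quotient _ (smul_top_le_comap ρT (p : ℤ))) (ρ₁.quotient _ (smul_top_le_comap ρ₁ (p : ℤ)))
    (ρP.quotient _ (smul_top_le_comap ρP (p : ℤ))) f g ?_ ?_ ?_ ?_ ?_ ‹_›
    (smul_quotient_smul_top_eq_zero (p : ℤ))
  · -- `f` equivariant
    intro s x
    obtain ⟨t, rfl⟩ := mkQ_surjective _ x
    rfl
  · -- `g` equivariant
    intro s x
    obtain ⟨y, rfl⟩ := mkQ_surjective _ x
    change Submodule.Quotient.mk (jP (ρ₁ s y)) = Submodule.Quotient.mk (ρP s (jP y))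
    congr 1
    exact Subtype.ext (hj s y)
  · -- `f` injective
    rw [← LinearMap.ker_eq_bot, eq_bot_iff]
    intro x hx
    obtain ⟨t, rfl⟩ := mkQ_surjective _ x
    rw [mkQ_apply, LinearMap.mem_ker, mapQ_apply, Submodule.Quotient.mk_eq_zero,
      mem_smul_top_iff] at hx
    obtain ⟨l, hl⟩ := hx
    have hl' : j l = 0 := by
      apply htor₂
      rw [← map_zsmul, hl, Submodule.coe_subtype]
      exact t.2
    rw [mem_bot, mkQ_apply, Submodule.Quotient.mk_eq_zero, mem_smul_top_iff]
    exact ⟨⟨l, hl'⟩, Subtype.ext hl⟩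
  · -- `g` surjective
    intro z
    obtain ⟨q, rfl⟩ := mkQ_surjective _ z
    obtain ⟨y, rfl⟩ := j.surjective_rangeRestrict q
    exact ⟨Submodule.Quotient.mk y, rfl⟩
  · -- exactness in the middle
    apply le_antisymm
    · rintro _ ⟨x, rfl⟩
      obtain ⟨t, rfl⟩ := mkQ_surjective _ x
      rw [LinearMap.mem_ker, mkQ_apply, mapQ_apply, mapQ_apply, Submodule.Quotient.mk_eq_zero]
      have : jP (T.subtype t) = 0 := Subtype.ext (by simp [jP])
      rw [this]
      exact zero_mem _
    · intro x hx
      obtain ⟨l, rfl⟩ := mkQ_surjective _ x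
      rw [LinearMap.mem_ker, mkQ_apply, mapQ_apply, Submodule.Quotient.mk_eq_zero, mem_smul_top_iff] at hx
      obtain ⟨q, hq⟩ := hx
      obtain ⟨m, rfl⟩ := j.surjective_rangeRestrict q
      have hlm : l - (p : ℤ) • m ∈ T := by
        rw [hTdef, LinearMap.mem_ker, map_sub, map_zsmul, sub_eq_zero]
        exact (congrArg Subtype.val hq).symm
      refine ⟨Submodule.Quotient.mk ⟨l - (p : ℤ) • m, hlm⟩, ?_⟩
      rw [mapQ_apply, mkQ_apply]
      change Submodule.Quotient.mk (l - (p : ℤ) • m) = Submodule.Quotient.mk l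
      rw [Submodule.Quotient.eq, sub_sub_cancel_left, neg_mem_iff]
      exact (mem_smul_top_iff _ _).2 ⟨m, rfl⟩

/-! ### §2. Finite cyclic torsion: `ψ(T/pT) = ψ(T[p])` -/

omit hψ in
/-- In a finite cyclic group at most `k` elements are killed by `k` (`Nat.card` form of Mathlib's
`IsAddCyclic.card_nsmul_eq_zero_le`). [cite: SerreLinearRepresentations1977, §15.2] -/
theorem natCard_nsmul_eq_zero_le {T : Type u} [AddCommGroup T] [Finite T] [IsAddCyclic T]
    {k : ℕ} (hk : 0 < k) : Nat.card {a : T // k • a = 0} ≤ k := by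
  classical
  letI := Fintype.ofFinite T
  rw [Nat.card_eq_fintype_card, Fintype.card_subtype]
  exact IsAddCyclic.card_nsmul_eq_zero_le hk

omit hψ in
/-- `#(ker φ) · #(range φ) = #T` for an endomorphism of a finite module (first isomorphism theorem).
[cite: SerreLinearRepresentations1977, §15.2] -/
theorem natCard_ker_mul_natCard_range {T : Type u} [AddCommGroup T] [Finite T] (φ : T →ₗ[ℤ] T) :
    Nat.card (LinearMap.ker φ) * Nat.card (LinearMap.range φ) = Nat.card T := by
  rw [Submodule.card_eq_card_quotient_mul_card (LinearMap.ker φ),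
    Nat.card_congr φ.quotKerEquivRange.toEquiv]

/-- **`ψ(T/pT) = ψ(T[p])` for a finite CYCLIC `ℤ[G]`-module `T`** (any `ℤ`-linear `G`-action):
if `p ∤ #T` both sides vanish; if `#T = p·m`, multiplication by `m` induces a `G`-isomorphism
`T/pT ≅ T[p]` (in a cyclic group `#{x | k x = 0} ≤ k`, which pins down `ker (m·) = pT` and
`im (m·) = T[p]`).  "The Herbrand quotient of a finite module is `1`" in the only form available to
an invariant that is additive on `p`-torsion modules alone.
[cite: MilneADT2006, I Lemma 2.12 and Lemma 5.3 (proof)] [cite: CasselsFrohlichANT1967, Ch. IV §8 (Prop. 11: `h(A) = 1` for finite `A`)] -/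
theorem additive_reduction_eq_torsionBy_of_isAddCyclic [hp : Fact p.Prime] {T : Type u}
    [AddCommGroup T] [Finite T] [IsAddCyclic T] (ρT : Representation ℤ G T) :
    ψ (ρT.quotient ((p : ℤ) • ⊤) (smul_top_le_comap ρT (p : ℤ))) =
      ψ (ρT.subrepresentation (torsionBy ℤ T (p : ℤ)) (torsionBy_le_comap ρT (p : ℤ))) := by
  classical
  obtain ⟨good_sub, good_quot, hψ'⟩ := admissible ψ hψ
  -- the two sides are "good"
  have goodP : Finite (torsionBy ℤ T (p : ℤ)) ∧ ∀ y : torsionBy ℤ T (p : ℤ), (p : ℤ) • y = 0 :=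
    ⟨inferInstance, fun y => Subtype.ext (by
      rw [Submodule.coe_smul, Submodule.coe_zero]; exact (mem_torsionBy_iff _ _).1 y.2)⟩
  -- vanishing on trivial modules, from `hψ` alone
  have hzero : ∀ {X : Type u} [AddCommGroup X] [Module ℤ X] [Subsingleton X]
      (ρX : Representation ℤ G X), ψ ρX = 0 := by
    intro X _ _ _ ρX
    haveI : Finite X := Finite.of_subsingleton
    have h := hψ ρX ρX ρX LinearMap.id LinearMap.id (fun _ _ => rfl) (fun _ _ => rfl)
      injective_id surjective_id (by rw [range_id, ker_id]; exact Subsingleton.elim _ _) ‹_›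
      (fun y => Subsingleton.elim _ _)
    have h2 : ψ ρX + ψ ρX = ψ ρX + 0 := by rw [add_zero]; exact h.symm
    exact add_left_cancel h2
  -- `#{x | p x = 0} ≤ p`, as `Nat.card` of the `torsionBy` submodule
  have hcardP : Nat.card (torsionBy ℤ T (p : ℤ)) ≤ p := by
    rw [Nat.card_congr (β := {a : T // p • a = 0}) (Equiv.subtypeEquivRight (fun x => by
      rw [mem_torsionBy_iff, natCast_zsmul]))]
    exact natCard_nsmul_eq_zero_le hp.out.pos
  by_cases hdvd : p ∣ Nat.card T
  · obtain ⟨m, hm⟩ := hdvd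
    have hm0 : 0 < m := Nat.pos_of_ne_zero fun h => by
      rw [h, mul_zero] at hm; exact Nat.card_pos.ne' hm
    let φ : T →ₗ[ℤ] T := (m : ℤ) • LinearMap.id
    have hφ : ∀ x, φ x = (m : ℤ) • x := fun x => rfl
    have hφρ : ∀ s x, φ (ρT s x) = ρT s (φ x) := fun s x => by rw [hφ, hφ, map_zsmul]
    -- `range φ ≤ T[p]`, `pT ≤ ker φ`
    have h1 : LinearMap.range φ ≤ torsionBy ℤ T (p : ℤ) := by
      rintro _ ⟨x, rfl⟩
      rw [mem_torsionBy_iff, hφ, smul_smul, ← Nat.cast_mul, ← hm, natCast_zsmul]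
      exact card_nsmul_eq_zero'
    have h2 : ((p : ℤ) • ⊤ : Submodule ℤ T) ≤ LinearMap.ker φ := by
      intro x hx
      obtain ⟨y, rfl⟩ := (mem_smul_top_iff _ _).1 hx
      rw [LinearMap.mem_ker, hφ, smul_smul, mul_comm, ← Nat.cast_mul, ← hm, natCast_zsmul]
      exact card_nsmul_eq_zero'
    -- counting
    have hcardK : Nat.card (LinearMap.ker φ) ≤ m := by
      rw [Nat.card_congr (β := {a : T // m • a = 0}) (Equiv.subtypeEquivRight (fun x => by
        rw [LinearMap.mem_ker, hφ, natCast_zsmul]))]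
      exact natCard_nsmul_eq_zero_le hm0
    have hprod := natCard_ker_mul_natCard_range φ
    rw [hm] at hprod
    have hR : Nat.card (LinearMap.range φ) ≤ Nat.card (torsionBy ℤ T (p : ℤ)) :=
      Nat.card_mono (Set.toFinite _) h1
    have hRp : Nat.card (LinearMap.range φ) = p := by
      apply le_antisymm (hR.trans hcardP)
      by_contra hlt
      rw [not_le] at hlt
      have : Nat.card (LinearMap.ker φ) * Nat.card (LinearMap.range φ) < m * p :=
        calc Nat.card (LinearMap.ker φ) * Nat.card (LinearMap.range φ)
            ≤ m * Nat.card (LinearMap.range φ) := Nat.mul_le_mul_right _ hcardK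
          _ < m * p := Nat.mul_lt_mul_of_pos_left hlt hm0
      rw [hprod, mul_comm] at this
      exact lt_irrefl _ this
    have hKm : Nat.card (LinearMap.ker φ) = m := by
      have h := hprod
      rw [hRp, mul_comm p] at h
      exact Nat.eq_of_mul_eq_mul_right hp.out.pos h
    -- `range φ = T[p]`
    have hReq : LinearMap.range φ = torsionBy ℤ T (p : ℤ) :=
      SetLike.coe_injective (Set.eq_of_subset_of_ncard_le h1
        (by rw [← Nat.card_coe_set_eq, ← Nat.card_coe_set_eq, SetLike.coe_sort_coe,
              SetLike.coe_sort_coe]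
            exact hcardP.trans hRp.ge) (Set.toFinite _))
    -- `#(pT) = m`: from the endomorphism `p·` whose kernel is `T[p]` (of order `p`) and range `pT`
    let π : T →ₗ[ℤ] T := (p : ℤ) • LinearMap.id
    have hkerπ : LinearMap.ker π = torsionBy ℤ T (p : ℤ) := by
      ext x; rw [LinearMap.mem_ker, mem_torsionBy_iff]; rfl
    have hranπ : LinearMap.range π = (p : ℤ) • ⊤ := by
      ext x; rw [LinearMap.mem_range, mem_smul_top_iff]; rfl
    have hTp : Nat.card (torsionBy ℤ T (p : ℤ)) = p := by rw [← hReq, hRp]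
    have hcardpT : Nat.card ((p : ℤ) • ⊤ : Submodule ℤ T) = m := by
      have h := natCard_ker_mul_natCard_range π
      rw [hkerπ, hranπ, hTp, hm] at h
      exact Nat.eq_of_mul_eq_mul_left hp.out.pos h
    -- `pT = ker φ`
    have hKeq : ((p : ℤ) • ⊤ : Submodule ℤ T) = LinearMap.ker φ :=
      SetLike.coe_injective (Set.eq_of_subset_of_ncard_le h2
        (by rw [← Nat.card_coe_set_eq, ← Nat.card_coe_set_eq, SetLike.coe_sort_coe,
          SetLike.coe_sort_coe, hKm, hcardpT])
        (Set.toFinite _))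
    -- the `G`-isomorphism `T/pT ≅ T[p]`
    let e : (T ⧸ ((p : ℤ) • ⊤ : Submodule ℤ T)) ≃ₗ[ℤ] torsionBy ℤ T (p : ℤ) :=
      (Submodule.quotEquivOfEq _ _ hKeq).trans (φ.quotKerEquivRange.trans (LinearEquiv.ofEq _ _ hReq))
    have he : ∀ x : T, (e (Submodule.Quotient.mk x) : T) = (m : ℤ) • x := fun x => rfl
    refine Admissible.additive_eq_of_linearEquiv ψ _ good_quot hψ' _ _ goodP e (fun s q => ?_)
    obtain ⟨x, rfl⟩ := mkQ_surjective _ q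
    apply Subtype.ext
    change (e (Submodule.Quotient.mk (ρT s x)) : T) = ρT s (e (Submodule.Quotient.mk x) : T)
    rw [he, he, map_zsmul]
  · -- `p ∤ #T`: both sides are trivial modules
    have hinj : ∀ x : T, p • x = 0 → x = 0 := fun x hx => by
      have h1 : addOrderOf x ∣ p := addOrderOf_dvd_of_nsmul_eq_zero hx
      have h2 : addOrderOf x ∣ Nat.card T := addOrderOf_dvd_natCard x
      rcases (Nat.dvd_prime hp.out).1 h1 with h | h
      · exact AddMonoid.addOrderOf_eq_one_iff.1 h
      · exact absurd (h ▸ h2) hdvd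
    haveI : Subsingleton (torsionBy ℤ T (p : ℤ)) := ⟨fun a b => Subtype.ext (by
      rw [hinj a (by rw [← natCast_zsmul]; exact (mem_torsionBy_iff _ _).1 a.2),
        hinj b (by rw [← natCast_zsmul]; exact (mem_torsionBy_iff _ _).1 b.2)])⟩
    have hsurj : Function.Surjective fun x : T => p • x :=
      Finite.surjective_of_injective fun a b hab => sub_eq_zero.1 (hinj _ (by
        rw [smul_sub]; exact sub_eq_zero.2 hab))
    haveI : Subsingleton (T ⧸ ((p : ℤ) • ⊤ : Submodule ℤ T)) := ⟨fun a b => by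
      obtain ⟨x, rfl⟩ := mkQ_surjective _ a
      obtain ⟨y, rfl⟩ := mkQ_surjective _ b
      rw [mkQ_apply, mkQ_apply, Submodule.Quotient.eq, mem_smul_top_iff]
      obtain ⟨z, hz⟩ := hsurj (x - y)
      exact ⟨z, by rw [natCast_zsmul]; exact hz⟩⟩
    rw [hzero (ρT.quotient _ _), hzero (ρT.subrepresentation _ _)]

/-! ### §3. From a rational isomorphism of representations to the reductions mod `p` -/

/-- **From an isomorphism of RATIONAL representations to reductions mod `p`.**  Let `Λ₁`, `Λ₂` be
finitely generated `ℤ[G]`-modules with `G`-maps `i₁ : Λ₁ → V`, `i₂ : Λ₂ → V` into one `ℚ[G]`-module,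
both with `ℚ`-spanning image, `i₂` injective, and suppose the kernel of `i₁` (the torsion of `Λ₁`
when `i₁` is a rational structure) is CYCLIC.  Then for every invariant `ψ` additive on finite
`p`-torsion `ℤ[G]`-modules: **`ψ(Λ₁/pΛ₁) = ψ(Λ₁[p]) + ψ(Λ₂/pΛ₂)`**.  Proof: a `G`-map `j : Λ₁ → Λ₂`
with image of finite index and `ker j = ker i₁` (`exists_equivariant_hom_of_span_eq_top`); Serre's
Thm. 32 `ψ(Λ₂/p) = ψ(j(Λ₁)/p)`; §1 `ψ(Λ₁/p) = ψ(T/pT) + ψ(j(Λ₁)/p)`; §2 `ψ(T/pT) = ψ(T[p]) = ψ(Λ₁[p])`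
(`Λ₁[p] ⊆ T = ker i₁` since `V` is torsion-free).
[cite: SerreLinearRepresentations1977, §15.2 Thm. 32] [cite: MilneADT2006, I Lemma 2.12]
[cite: CasselsFrohlichANT1967, Ch. VII §8.3 (two lattices in one `G`-space)] -/
theorem additive_reduction_eq_torsionBy_add_of_span_eq_top [hp : Fact p.Prime]
    {V : Type v} [AddCommGroup V] [Module ℚ V] (τ : Representation ℚ G V)
    {Λ₁ Λ₂ : Type u} [AddCommGroup Λ₁] [AddCommGroup Λ₂] [Module.Finite ℤ Λ₁] [Module.Finite ℤ Λ₂]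
    (ρ₁ : Representation ℤ G Λ₁) (ρ₂ : Representation ℤ G Λ₂)
    (i₁ : Λ₁ →ₗ[ℤ] V) (i₂ : Λ₂ →ₗ[ℤ] V)
    (h₁ : ∀ s x, i₁ (ρ₁ s x) = τ s (i₁ x)) (h₂ : ∀ s x, i₂ (ρ₂ s x) = τ s (i₂ x))
    (hi₂ : Injective i₂) (hsp₁ : span ℚ (Set.range i₁) = ⊤) (hsp₂ : span ℚ (Set.range i₂) = ⊤)
    [Finite (LinearMap.ker i₁)] [IsAddCyclic (LinearMap.ker i₁)] :
    ψ (ρ₁.quotient ((p : ℤ) • ⊤) (smul_top_le_comap ρ₁ (p : ℤ))) =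
      ψ (ρ₁.subrepresentation (torsionBy ℤ Λ₁ (p : ℤ)) (torsionBy_le_comap ρ₁ (p : ℤ))) +
        ψ (ρ₂.quotient ((p : ℤ) • ⊤) (smul_top_le_comap ρ₂ (p : ℤ))) := by
  classical
  obtain ⟨good_sub, good_quot, hψ'⟩ := admissible ψ hψ
  have hp0 : (p : ℤ) ≠ 0 := by exact_mod_cast hp.out.ne_zero
  -- `V` is torsion-free
  have hV : ∀ v : V, (p : ℤ) • v = 0 → v = 0 := fun v hv => by
    have h' : (p : ℚ)⁻¹ • ((p : ℚ) • v) = 0 := by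
      rw [show ((p : ℚ) • v) = ((p : ℤ) : ℚ) • v by rw [Int.cast_natCast],
        Int.cast_smul_eq_zsmul ℚ (p : ℤ), hv, smul_zero]
    rwa [smul_smul, inv_mul_cancel₀ (by exact_mod_cast hp.out.ne_zero : (p : ℚ) ≠ 0), one_smul] at h'
  have htor₂ : ∀ y : Λ₂, (p : ℤ) • y = 0 → y = 0 := fun y hy =>
    hi₂ (by rw [map_zero]; exact hV _ (by rw [← map_zsmul, hy, map_zero]))
  -- the `G`-map `j : Λ₁ → Λ₂`
  obtain ⟨N, j, hN, hj, hjρ, hfin⟩ :=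
    exists_equivariant_hom_of_span_eq_top τ ρ₁ ρ₂ i₁ i₂ h₁ h₂ hi₂ hsp₁ hsp₂
  have hker : LinearMap.ker j = LinearMap.ker i₁ := ker_eq_ker_of_comp_eq_smul i₁ i₂ hi₂ j hN hj
  haveI : Finite (Λ₁ ⧸ ((p : ℤ) • ⊤ : Submodule ℤ Λ₁)) := finite_quotient_smul_top hp0
  haveI : Finite (Λ₂ ⧸ ((p : ℤ) • ⊤ : Submodule ℤ Λ₂)) := finite_quotient_smul_top hp0
  haveI := hfin
  -- the kernel `T = ker j = ker i₁` is finite cyclic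
  let eK : LinearMap.ker i₁ ≃ₗ[ℤ] LinearMap.ker j := LinearEquiv.ofEq _ _ hker.symm
  haveI : Finite (LinearMap.ker j) := Finite.of_equiv _ eK.toEquiv
  haveI : IsAddCyclic (LinearMap.ker j) := isAddCyclic_of_surjective eK.toAddMonoidHom eK.surjective
  -- (1) Serre: `ψ(Λ₂/p) = ψ(j(Λ₁)/p)`
  have e1 := additive_reduction_eq_of_finite_index ψ hψ ρ₂ htor₂ (LinearMap.range j)
    (range_le_comap_of_comm ρ₁ ρ₂ j hjρ)
  -- (2) `ψ(Λ₁/p) = ψ(T/pT) + ψ(j(Λ₁)/p)`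
  have e2 := additive_reduction_eq_ker_add_range ψ hψ ρ₁ ρ₂ j hjρ htor₂
  -- (3) `ψ(T/pT) = ψ(T[p])`
  have e3 := additive_reduction_eq_torsionBy_of_isAddCyclic ψ hψ
    (ρ₁.subrepresentation (LinearMap.ker j) (ker_le_comap_of_comm ρ₁ ρ₂ j hjρ))
  -- (4) `T[p] ≅ Λ₁[p]`
  have hsub : ∀ x : Λ₁, (p : ℤ) • x = 0 → x ∈ LinearMap.ker j := fun x hx => by
    rw [hker, LinearMap.mem_ker]
    exact hV _ (by rw [← map_zsmul, hx, map_zero])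
  let ρT := ρ₁.subrepresentation (LinearMap.ker j) (ker_le_comap_of_comm ρ₁ ρ₂ j hjρ)
  have hmemT : ∀ x : torsionBy ℤ (LinearMap.ker j) (p : ℤ),
      ((x : LinearMap.ker j) : Λ₁) ∈ torsionBy ℤ Λ₁ (p : ℤ) := fun x => by
    have hx := congrArg Subtype.val ((mem_torsionBy_iff _ _).1 x.2)
    rw [Submodule.coe_smul, Submodule.coe_zero] at hx
    exact (mem_torsionBy_iff _ _).2 hx
  let f : torsionBy ℤ (LinearMap.ker j) (p : ℤ) →ₗ[ℤ] torsionBy ℤ Λ₁ (p : ℤ) :=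
    LinearMap.codRestrict _ ((LinearMap.ker j).subtype ∘ₗ (torsionBy ℤ (LinearMap.ker j) (p : ℤ)).subtype)
      hmemT
  have hfbij : Function.Bijective f := by
    constructor
    · intro a b hab
      exact Subtype.ext (Subtype.ext (congrArg (fun y : torsionBy ℤ Λ₁ (p : ℤ) => (y : Λ₁)) hab))
    · intro y
      have hy := (mem_torsionBy_iff _ _).1 y.2
      refine ⟨⟨⟨(y : Λ₁), hsub _ hy⟩, (mem_torsionBy_iff _ _).2 (Subtype.ext ?_)⟩, Subtype.ext rfl⟩
      rw [Submodule.coe_smul, Submodule.coe_zero]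
      exact hy
  let e : torsionBy ℤ (LinearMap.ker j) (p : ℤ) ≃ₗ[ℤ] torsionBy ℤ Λ₁ (p : ℤ) :=
    LinearEquiv.ofBijective f hfbij
  haveI : Finite (torsionBy ℤ Λ₁ (p : ℤ)) := Finite.of_surjective f hfbij.2
  have e4 : ψ (ρT.subrepresentation (torsionBy ℤ (LinearMap.ker j) (p : ℤ)) (torsionBy_le_comap ρT (p : ℤ))) =
      ψ (ρ₁.subrepresentation (torsionBy ℤ Λ₁ (p : ℤ)) (torsionBy_le_comap ρ₁ (p : ℤ))) :=
    Admissible.additive_eq_of_linearEquiv ψ _ good_quot hψ' _ _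
      ⟨‹_›, fun y => Subtype.ext (by
        rw [Submodule.coe_smul, Submodule.coe_zero]; exact (mem_torsionBy_iff _ _).1 y.2)⟩
      e (fun _ _ => rfl)
  rw [e2, e3, e4, ← e1]

end Additive

end StableLatticeReduction.Int

end Literature.RepresentationTheory.FiniteGroups
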